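import Literature.Probability.LatticeModels.ObservableContinuumBounds
import Literature.Probability.LatticeModels.ScalingLimitRiemannSums
import Mathlib.Analysis.Complex.HasPrimitives
import HarnessLib

/-!
# Subsequential limits of the renormalised FK-Ising observable are holomorphic (discrete Cauchy + Morera)

Topic `Literature/Probability/LatticeModels`; an instalment (item B2 of the road recorded in
`Sweep1Proofs.lean`, module docstring §2b) of the discharge programme for crit-ising.S18 /
Smirnov's Theorem 2.2. Smirnov 2010, §5: "… the limit `f` of `F_j/√δ_j` satisfies, by Remark 3.3,
the discrete Cauchy–Riemann relations in the limit; by Morera's theorem it is analytic". We prove: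
if `δ_k^{-1/2} F_{δ_k} → g` uniformly on compacts of `D` along a sequence of meshes `δ_k → 0⁺` of
a discretisation `E` with the analytic hypotheses `ObsHyp` eventually, and `g` is continuous on
`D`, then `g` is holomorphic on `D` (`IsDiscretisation.differentiableOn_of_limit`).

The proof is Morera's theorem in Mathlib's rectangle form
(`Complex.isConservativeOn_and_continuousOn_iff_isDifferentiableOn`): for a rectangle `R ⊆ D`
with ordered corners, the discrete Cauchy theorem `boundary_sum_eq_zero_of_cr`
(`DiscreteCauchyRiemann.lean`) for the observable on the lattice grid inscribed in `R` (all of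
whose vertices and faces satisfy the discrete Cauchy–Riemann relations once the mesh is fine, by
s-holomorphicity `crVertex/crFace_phasedObservable` and the bulk radius of
`ObservableContinuumBounds.lean`) says that a signed sum of edge values over the four sides
vanishes; multiplied by `(δ/2) δ^{-1/2}` it is a sum of eight Riemann sums of `δ^{-1/2}F_δ` along
the sides (the vertical edge values being within `O(δ√δ)` of the horizontal ones,
`exists_cross_bound`), which converge (`tendsto_mul_sum_of_tendstoUniformlyOn`) to
`(∫_top - ∫_bottom) g dx - i (∫_right - ∫_left) g dy = -(wedge z w + wedge w z)`. The other corner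
orders follow from the symmetries of the rectangle integral. Everything is proved.

* `crVertex_const_mul_iff`, `crFace_const_mul_iff`, `ObsHyp.crVertex_obsAt`, `ObsHyp.crFace_obsAt`;
  `meshPoint_vtx`, `fkObservableOfData_meshPoint`; grid geometry `floor_mul_le_of_le`,
  `dist_meshPoint_vtx_le`, `meshPoint_vtx_mem_cthickening`, `dist_meshPoint_vtx_row_le`,
  `dist_meshPoint_vtx_col_le`, `row_image_subset_cthickening`, `col_image_subset_cthickening`.
* `scaledObs E s k = δ_k^{-1/2} F_{δ_k}`, `obsAt_eq_sqrt_mul_scaledObs`;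
  **`wedgeIntegral_add_eq_zero_core`** (ordered corners, static estimates from the start);
  `tendstoUniformlyOn_shift`, `rectangle_eq_of_diag`;
  **`IsDiscretisation.differentiableOn_of_limit`**.

## References

* S. Smirnov, Ann. of Math. 172 (2010) 1435–1467, Remark 3.3 and §5 — bib key `Smirnov2010`.
-/

noncomputable section

namespace Literature.Probability.LatticeModels

open Filter _root_.Topology Metric Set Finset Complex

/-! ### Linearity of the Cauchy–Riemann predicates -/

/-- `CRVertex` is invariant under multiplication by a nonzero constant. [folklore] -/
theorem crVertex_const_mul_iff {F : MedialVertex → ℂ} {c : ℂ} (hc : c ≠ 0) (v : Site 2) :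
    CRVertex (fun z => c * F z) v ↔ CRVertex F v := by
  unfold CRVertex
  rw [← mul_sub, ← mul_sub, mul_left_comm, mul_right_inj' hc]

/-- `CRFace` is invariant under multiplication by a nonzero constant. [folklore] -/
theorem crFace_const_mul_iff {F : MedialVertex → ℂ} {c : ℂ} (hc : c ≠ 0) (f : Site 2) :
    CRFace (fun z => c * F z) f ↔ CRFace F f := by
  unfold CRFace
  rw [← mul_sub, ← mul_sub, mul_left_comm, mul_right_inj' hc]

namespace ObsHyp

variable {E : DiscreteDobrushin} (H : ObsHyp E)

/-- **Cauchy–Riemann at a vertex for `obsAt`**, all of whose edges are interior. [cite: Smirnov2010, Remark 3.3 with Lemma 4.5] -/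
theorem crVertex_obsAt {v : Site 2} (hv : ∀ k : Fin 4, E.IsInteriorEdge v k) : CRVertex (obsAt E H.adm) v := by
  letI := E.admFintype H.adm
  have h := crVertex_phasedObservable (hE := H.adm) H.arcA hv
  exact (crVertex_const_mul_iff (refPhase_ne_zero _) v).1 h

/-- **Cauchy–Riemann at a face for `obsAt`**, all of whose corners have interior edges. [cite: Smirnov2010, Remark 3.3 with Lemma 4.5] -/
theorem crFace_obsAt {f : Site 2} (hf : ∀ j k : Fin 4, E.IsInteriorEdge (f + cornerOff j) k) : CRFace (obsAt E H.adm) f := by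
  letI := E.admFintype H.adm
  have h := crFace_phasedObservable (hE := H.adm) H.arcA hf
  exact (crFace_const_mul_iff (refPhase_ne_zero _) f).1 h

end ObsHyp

/-! ### Mesh points of the grid vertices -/

/-- `meshPoint δ (vtx b i j) = meshPoint δ b + δ (i + j i)`. [folklore] -/
theorem meshPoint_vtx (δ : ℝ) (b : Site 2) (i j : ℤ) :
    meshPoint δ (vtx b i j) = meshPoint δ b + (δ : ℂ) * ((i : ℂ) + (j : ℂ) * I) := by
  apply Complex.ext
  · simp [meshPoint_re, vtx, cornerUnit]; ring
  · simp [meshPoint_im, vtx, cornerUnit]; ring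

/-- The renormalised lattice observable read at a lattice point is the horizontal edge value:
`δ^{-1/2} F_δ (meshPoint δ x) = δ^{-1/2} F(cSrc (x, 0))`. [cite: Smirnov2010, §2] -/
theorem fkObservableOfData_meshPoint {E : DiscreteDobrushin} (hE : E.IsZdAdmissible) {δ : ℝ} (hδ : E.δ = δ)
    (hδ0 : δ ≠ 0) (x : Site 2) :
    fkObservableOfData E (meshPoint δ x) = obsAt E hE (cSrc (x, 0)) := by
  rw [fkObservableOfData_eq_obsAt hE, medialVertexAt_eq_cSrc, hδ, nearestSite_meshPoint hδ0]

/-! ### Geometry of the lattice grid of a rectangle -/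

section Grid

variable {δ : ℝ} (hδ : 0 < δ) (z w : ℂ) (hre : z.re ≤ w.re) (him : z.im ≤ w.im)

/-- Floor bookkeeping: `m = ⌊(x₁ - x₀)/δ⌋₊` satisfies `m δ ≤ x₁ - x₀ < (m + 1) δ`. [folklore] -/
theorem floor_mul_le_of_le {a : ℝ} (ha : 0 ≤ a) (hδ : 0 < δ) :
    (⌊a / δ⌋₊ : ℝ) * δ ≤ a ∧ a < (⌊a / δ⌋₊ + 1) * δ := by
  constructor
  · have := Nat.floor_le (div_nonneg ha hδ.le)
    calc (⌊a / δ⌋₊ : ℝ) * δ ≤ a / δ * δ := by gcongr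
      _ = a := div_mul_cancel₀ a hδ.ne'
  · have := Nat.lt_floor_add_one (a / δ)
    calc a = a / δ * δ := (div_mul_cancel₀ a hδ.ne').symm
      _ < (⌊a / δ⌋₊ + 1) * δ := by gcongr

include hδ in
/-- The mesh point of the grid vertex `(i, j)` is within `δ` of the point `z + δ(i + j i)`. [folklore] -/
theorem dist_meshPoint_vtx_le (i j : ℤ) :
    dist (meshPoint δ (vtx (nearestSite δ z) i j)) (z + (δ : ℂ) * ((i : ℂ) + (j : ℂ) * I)) ≤ δ := by
  rw [meshPoint_vtx, dist_add_right]
  exact dist_meshPoint_nearestSite_le hδ z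

include hδ hre him in
/-- Grid vertices `(i, j)`, `-1 ≤ i ≤ m + 1`, `-1 ≤ j ≤ n + 1`, have mesh points within `3δ` of the
rectangle. [folklore] -/
theorem meshPoint_vtx_mem_cthickening {i j : ℤ} (hi : -1 ≤ i) (hi' : i ≤ ⌊(w.re - z.re) / δ⌋₊ + 1)
    (hj : -1 ≤ j) (hj' : j ≤ ⌊(w.im - z.im) / δ⌋₊ + 1) :
    meshPoint δ (vtx (nearestSite δ z) i j) ∈ cthickening (3 * δ) (Rectangle z w) := by
  set m := ⌊(w.re - z.re) / δ⌋₊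
  set n := ⌊(w.im - z.im) / δ⌋₊
  obtain ⟨hm1, hm2⟩ := floor_mul_le_of_le (a := w.re - z.re) (by linarith) hδ
  obtain ⟨hn1, hn2⟩ := floor_mul_le_of_le (a := w.im - z.im) (by linarith) hδ
  -- clamp the indices into `[0, m] × [0, n]`
  set i' : ℤ := max 0 (min i m) with hi'def
  set j' : ℤ := max 0 (min j n) with hj'def
  have hi'0 : 0 ≤ i' := le_max_left _ _
  have hi'm : i' ≤ m := max_le (by exact_mod_cast Nat.zero_le m) (min_le_right _ _)
  have hj'0 : 0 ≤ j' := le_max_left _ _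
  have hj'n : j' ≤ n := max_le (by exact_mod_cast Nat.zero_le n) (min_le_right _ _)
  have hii'Z : |i - i'| ≤ 1 := by
    have h := hi'def; rw [max_def, min_def] at h; rw [abs_le]; split_ifs at h <;> omega
  have hjj'Z : |j - j'| ≤ 1 := by
    have h := hj'def; rw [max_def, min_def] at h; rw [abs_le]; split_ifs at h <;> omega
  have hii' : |(i : ℝ) - i'| ≤ 1 := by exact_mod_cast hii'Z
  have hjj' : |(j : ℝ) - j'| ≤ 1 := by exact_mod_cast hjj'Z
  -- the anchor point `q = z + δ (i' + j' i)` lies in the rectangle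
  set q : ℂ := z + (δ : ℂ) * ((i' : ℂ) + (j' : ℂ) * I) with hq
  have hqR : q ∈ Rectangle z w := by
    rw [Rectangle, mem_reProdIm, uIcc_of_le hre, uIcc_of_le him]
    have hi'r : (0 : ℝ) ≤ i' := by exact_mod_cast hi'0
    have hi'r' : (i' : ℝ) ≤ m := by exact_mod_cast hi'm
    have hj'r : (0 : ℝ) ≤ j' := by exact_mod_cast hj'0
    have hj'r' : (j' : ℝ) ≤ n := by exact_mod_cast hj'n
    simp only [hq, add_re, mul_re, ofReal_re, ofReal_im, add_im, mul_im, intCast_re, intCast_im, I_re, I_im,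
      mul_zero, mul_one, zero_mul, sub_zero, add_zero, zero_add]
    constructor <;> constructor <;> nlinarith
  refine Metric.mem_cthickening_of_dist_le _ q _ _ hqR ?_
  calc dist (meshPoint δ (vtx (nearestSite δ z) i j)) q
      ≤ dist (meshPoint δ (vtx (nearestSite δ z) i j)) (z + (δ : ℂ) * ((i : ℂ) + (j : ℂ) * I)) +
          dist (z + (δ : ℂ) * ((i : ℂ) + (j : ℂ) * I)) q := dist_triangle _ _ _
    _ ≤ δ + 2 * δ := by
        refine add_le_add (dist_meshPoint_vtx_le hδ z i j) ?_
        rw [hq, dist_add_left, dist_eq_norm, ← mul_sub, norm_mul, Complex.norm_real, Real.norm_eq_abs, abs_of_pos hδ]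
        have : ‖((i : ℂ) + (j : ℂ) * I) - ((i' : ℂ) + (j' : ℂ) * I)‖ ≤ 2 := by
          refine (norm_le_abs_re_add_abs_im _).trans ?_
          simp only [sub_re, add_re, mul_re, intCast_re, intCast_im, I_re, I_im, mul_zero, mul_one, sub_zero,
            sub_im, add_im, mul_im, add_zero, zero_add]
          have e1 : |(i : ℝ) - i'| ≤ 1 := hii'
          have e2 : |(j : ℝ) - j'| ≤ 1 := hjj'
          linarith
        nlinarith
    _ = 3 * δ := by ring

include hδ in
/-- **Sample points on the rows**: the grid vertex `(t, j)` is within `δ + |z.im + δ j - h|` of the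
point `h i + (z.re + t δ)` of the horizontal line at height `h`. [folklore] -/
theorem dist_meshPoint_vtx_row_le (t : ℕ) (j : ℤ) (h : ℝ) :
    dist (meshPoint δ (vtx (nearestSite δ z) t j)) ((h : ℂ) * I + ((z.re + t * δ : ℝ) : ℂ) * 1) ≤
      δ + |z.im + δ * j - h| := by
  have h1 := dist_meshPoint_vtx_le hδ z t j
  have e : z + (δ : ℂ) * (((t : ℤ) : ℂ) + (j : ℂ) * I) - ((h : ℂ) * I + ((z.re + t * δ : ℝ) : ℂ) * 1) =
      (((z.im + δ * j - h : ℝ)) : ℂ) * I := by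
    apply Complex.ext <;> simp; ring
  calc _ ≤ dist (meshPoint δ (vtx (nearestSite δ z) t j)) (z + (δ : ℂ) * (((t : ℤ) : ℂ) + (j : ℂ) * I)) +
        dist (z + (δ : ℂ) * (((t : ℤ) : ℂ) + (j : ℂ) * I)) ((h : ℂ) * I + ((z.re + t * δ : ℝ) : ℂ) * 1) :=
        dist_triangle _ _ _
    _ ≤ δ + |z.im + δ * j - h| := by
        refine add_le_add h1 ?_
        rw [dist_eq_norm, e, norm_mul, norm_I, mul_one, Complex.norm_real, Real.norm_eq_abs]

include hδ in
/-- **Sample points on the columns**: the grid vertex `(i, t)` is within `δ + |z.re + δ i - h|` of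
the point `h + (z.im + t δ) i` of the vertical line at abscissa `h`. [folklore] -/
theorem dist_meshPoint_vtx_col_le (i : ℤ) (t : ℕ) (h : ℝ) :
    dist (meshPoint δ (vtx (nearestSite δ z) i t)) ((h : ℂ) + ((z.im + t * δ : ℝ) : ℂ) * I) ≤
      δ + |z.re + δ * i - h| := by
  have h1 := dist_meshPoint_vtx_le hδ z i t
  have e : z + (δ : ℂ) * ((i : ℂ) + ((t : ℤ) : ℂ) * I) - ((h : ℂ) + ((z.im + t * δ : ℝ) : ℂ) * I) =
      (((z.re + δ * i - h : ℝ)) : ℂ) := by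
    apply Complex.ext <;> simp; ring
  calc _ ≤ dist (meshPoint δ (vtx (nearestSite δ z) i t)) (z + (δ : ℂ) * ((i : ℂ) + ((t : ℤ) : ℂ) * I)) +
        dist (z + (δ : ℂ) * ((i : ℂ) + ((t : ℤ) : ℂ) * I)) ((h : ℂ) + ((z.im + t * δ : ℝ) : ℂ) * I) :=
        dist_triangle _ _ _
    _ ≤ δ + |z.re + δ * i - h| := by
        refine add_le_add h1 ?_
        rw [dist_eq_norm, e, Complex.norm_real, Real.norm_eq_abs]

/-- The lines of the rectangle's sides, extended by `r/2`, stay in the `r`-thickening (rows). [folklore] -/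
theorem row_image_subset_cthickening {r : ℝ} (hr : 0 < r) {h : ℝ} (hh : h ∈ Icc z.im w.im) (hre : z.re ≤ w.re) :
    (fun s : ℝ => (h : ℂ) * I + (s : ℂ) * 1) '' Icc (z.re - r / 2) (z.re + (w.re - z.re) + r / 2) ⊆
      cthickening r (Rectangle z w) := by
  rintro _ ⟨t, ht, rfl⟩
  set t' := max z.re (min t w.re) with ht'
  have hq : ((t' : ℂ) + (h : ℂ) * I) ∈ Rectangle z w := by
    rw [Rectangle, mem_reProdIm, uIcc_of_le hre, uIcc_of_le (hh.1.trans hh.2)]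
    simp only [add_re, ofReal_re, mul_re, I_re, mul_zero, ofReal_im, I_im, mul_one, sub_self, add_zero,
      add_im, mul_im, zero_add]
    exact ⟨⟨le_max_left _ _, max_le hre (min_le_right _ _)⟩, hh⟩
  refine Metric.mem_cthickening_of_dist_le _ _ _ _ hq ?_
  rw [dist_eq_norm, show (h : ℂ) * I + (t : ℂ) * 1 - ((t' : ℂ) + (h : ℂ) * I) = ((t - t' : ℝ) : ℂ) by push_cast; ring,
    Complex.norm_real, Real.norm_eq_abs]
  rw [ht', abs_le, max_def, min_def]
  split_ifs <;> constructor <;> linarith [ht.1, ht.2]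

/-- The lines of the rectangle's sides, extended by `r/2`, stay in the `r`-thickening (columns). [folklore] -/
theorem col_image_subset_cthickening {r : ℝ} (hr : 0 < r) {h : ℝ} (hh : h ∈ Icc z.re w.re) (him : z.im ≤ w.im) :
    (fun s : ℝ => (h : ℂ) + (s : ℂ) * I) '' Icc (z.im - r / 2) (z.im + (w.im - z.im) + r / 2) ⊆
      cthickening r (Rectangle z w) := by
  rintro _ ⟨t, ht, rfl⟩
  set t' := max z.im (min t w.im) with ht'
  have hq : ((h : ℂ) + (t' : ℂ) * I) ∈ Rectangle z w := by
    rw [Rectangle, mem_reProdIm, uIcc_of_le (hh.1.trans hh.2), uIcc_of_le him]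
    simp only [add_re, ofReal_re, mul_re, I_re, mul_zero, ofReal_im, I_im, mul_one, sub_self, add_zero,
      add_im, mul_im, zero_add]
    exact ⟨hh, le_max_left _ _, max_le him (min_le_right _ _)⟩
  refine Metric.mem_cthickening_of_dist_le _ _ _ _ hq ?_
  rw [dist_eq_norm, show (h : ℂ) + (t : ℂ) * I - ((h : ℂ) + (t' : ℂ) * I) = ((t - t' : ℝ) : ℂ) * I by push_cast; ring,
    norm_mul, norm_I, mul_one, Complex.norm_real, Real.norm_eq_abs]
  rw [ht', abs_le, max_def, min_def]
  split_ifs <;> constructor <;> linarith [ht.1, ht.2]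

end Grid

/-! ### The discrete contour sum and its limit -/

section Core

variable {D : RandomPlanarGeometry.DobrushinDomain} {E : ℝ → DiscreteDobrushin}

/-- The renormalised observables `δ_k^{-1/2} F_{δ_k}` along a sequence of meshes. [cite: Smirnov2010, §5] -/
def scaledObs (E : ℝ → DiscreteDobrushin) (s : ℕ → ℝ) (k : ℕ) (ζ : ℂ) : ℂ :=
  ((Real.sqrt (s k))⁻¹ : ℂ) * fkObservableOfData (E (s k)) ζ

/-- Horizontal edge values are `√δ` times the renormalised observable at the mesh point. [cite: Smirnov2010, §5] -/
theorem obsAt_eq_sqrt_mul_scaledObs (hDE : IsDiscretisation D E) {s : ℕ → ℝ} {k : ℕ} (hk : 0 < s k)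
    (hE : (E (s k)).IsZdAdmissible) (x : Site 2) :
    obsAt (E (s k)) hE (cSrc (x, 0)) = (Real.sqrt (s k) : ℂ) * scaledObs E s k (meshPoint (s k) x) := by
  rw [scaledObs, fkObservableOfData_meshPoint hE (hDE.δ_eq _) hk.ne' x, ← mul_assoc, mul_inv_cancel₀, one_mul]
  exact_mod_cast (Real.sqrt_pos.2 hk).ne'

/-- **The discrete contour sum vanishes and its renormalisation converges to `-∮ g`** — the core of
the Morera argument, for `z.re ≤ w.re`, `z.im ≤ w.im`, along a sequence of meshes for which all the
static estimates hold from the start. Conclusion: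
`wedgeIntegral z w g + wedgeIntegral w z g = 0`. [cite: Smirnov2010, §5 (Morera's theorem)] -/
theorem wedgeIntegral_add_eq_zero_core (hDE : IsDiscretisation D E) {s : ℕ → ℝ} (hs0 : ∀ k, 0 < s k)
    (hs : Tendsto s atTop (𝓝 0)) {g : ℂ → ℂ} {z w : ℂ} (hre : z.re ≤ w.re) (him : z.im ≤ w.im)
    {K : Set ℂ} (hK : IsCompact K) (hg : ContinuousOn g K) {r : ℝ} (hr : 0 < r)
    (hKR : cthickening r (Rectangle z w) ⊆ K)
    (hconv : TendstoUniformlyOn (scaledObs E s) g atTop K)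
    (H : ∀ k, ObsHyp (E (s k))) (hsr : ∀ k, 3 * s k ≤ r)
    {ρ : ℝ} (hbulk : ∀ k, ∀ x y : Site 2, meshPoint (s k) x ∈ K →
      dist (meshPoint (s k) y) (meshPoint (s k) x) ≤ ρ → ∀ e : Fin 4, (E (s k)).IsInteriorEdge y e)
    (hsρ : ∀ k, 6 * s k ≤ ρ)
    {L : ℝ} (hcross : ∀ k, ∀ x : Site 2, meshPoint (s k) x ∈ K →
      ‖obsAt (E (s k)) (H k).adm (cSrc (x, 1)) - obsAt (E (s k)) (H k).adm (cSrc (x, 0))‖ ≤ L * s k * Real.sqrt (s k)) :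
    wedgeIntegral z w g + wedgeIntegral w z g = 0 := by
  -- notation
  set b : ℕ → Site 2 := fun k => nearestSite (s k) z with hb
  set m : ℕ → ℕ := fun k => ⌊(w.re - z.re) / s k⌋₊ with hm
  set n : ℕ → ℕ := fun k => ⌊(w.im - z.im) / s k⌋₊ with hn
  set F : ∀ k : ℕ, MedialVertex → ℂ := fun k => obsAt (E (s k)) (H k).adm with hF
  set u := scaledObs E s with hu
  set ℓx := w.re - z.re with hℓx
  set ℓy := w.im - z.im with hℓy
  have hℓx0 : 0 ≤ ℓx := by rw [hℓx]; linarith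
  have hℓy0 : 0 ≤ ℓy := by rw [hℓy]; linarith
  have hfloorx : ∀ k, (m k : ℝ) * s k ≤ ℓx ∧ ℓx < (m k + 1) * s k := fun k => floor_mul_le_of_le hℓx0 (hs0 k)
  have hfloory : ∀ k, (n k : ℝ) * s k ≤ ℓy ∧ ℓy < (n k + 1) * s k := fun k => floor_mul_le_of_le hℓy0 (hs0 k)
  -- (a) grid points are in `K`
  have hgridK : ∀ k (i j : ℤ), -1 ≤ i → i ≤ m k + 1 → -1 ≤ j → j ≤ n k + 1 → meshPoint (s k) (vtx (b k) i j) ∈ K := by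
    intro k i j hi hi' hj hj'
    have h3 := meshPoint_vtx_mem_cthickening (hs0 k) z w hre him hi hi' hj hj'
    exact hKR (cthickening_mono (hsr k) _ h3)
  -- (b) interior edges near grid points
  have hint : ∀ k (i j : ℤ), -1 ≤ i → i ≤ m k + 1 → -1 ≤ j → j ≤ n k + 1 →
      ∀ y : Site 2, DiscreteDobrushin.supNear (vtx (b k) i j) 3 y → ∀ e : Fin 4, (E (s k)).IsInteriorEdge y e := by
    intro k i j hi hi' hj hj' y hy e
    refine hbulk k _ y (hgridK k i j hi hi' hj hj') ?_ e
    have := DiscreteDobrushin.dist_meshPoint_le_of_supNear (hs0 k).le hy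
    push_cast at this; linarith [hsρ k]
  -- (c) the discrete contour sum vanishes
  have hBS : ∀ k,
      ∑ i ∈ Finset.range (m k + 1), (vmid (F k) (b k) i (n k) - vmid (F k) (b k) i (-1)) +
        ∑ i ∈ Finset.range (m k), (hmid (F k) (b k) i (n k) - hmid (F k) (b k) i 0) -
        I * (∑ j ∈ Finset.range (n k + 1), (hmid (F k) (b k) (m k) j - hmid (F k) (b k) (-1) j) +
          ∑ j ∈ Finset.range (n k), (vmid (F k) (b k) (m k) j - vmid (F k) (b k) 0 j)) = 0 := by
    intro k
    refine boundary_sum_eq_zero_of_cr (F k) (b k) (m k) (n k) (fun i j hi hj => ?_) (fun i j hi hj => ?_)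
    · refine (H k).crVertex_obsAt fun e => hint k i j (by omega) (by omega) (by omega) (by omega) _
        (DiscreteDobrushin.supNear_self _ (by norm_num)) e
    · refine (H k).crFace_obsAt fun j' e => hint k i j (by omega) (by omega) (by omega) (by omega) _ ?_ e
      intro c; fin_cases j' <;> fin_cases c <;> simp [cornerOff]
  -- (d) horizontal values in terms of `u`
  have hhor : ∀ k (x : Site 2), F k (cSrc (x, 0)) = (Real.sqrt (s k) : ℂ) * u k (meshPoint (s k) x) :=
    fun k x => obsAt_eq_sqrt_mul_scaledObs hDE (hs0 k) (H k).adm x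
  -- the renormalisation constant `c_k = (s k / 2) (√ s k)⁻¹`, with `c_k √(s k) = s k / 2`
  set c : ℕ → ℂ := fun k => ((s k / 2 : ℝ) : ℂ) * ((Real.sqrt (s k))⁻¹ : ℂ) with hc
  have hc_sqrt : ∀ k, c k * (Real.sqrt (s k) : ℂ) = ((s k / 2 : ℝ) : ℂ) := by
    intro k
    have : (Real.sqrt (s k) : ℂ) ≠ 0 := by exact_mod_cast (Real.sqrt_pos.2 (hs0 k)).ne'
    rw [hc, mul_assoc, inv_mul_cancel₀ this, mul_one]
  -- (e) the four side integrals
  set Itop := ∫ x : ℝ in z.re..w.re, g (x + w.im * I) with hItop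
  set Ibot := ∫ x : ℝ in z.re..w.re, g (x + z.im * I) with hIbot
  set Irig := ∫ y : ℝ in z.im..w.im, g (w.re + y * I) with hIrig
  set Ilef := ∫ y : ℝ in z.im..w.im, g (z.re + y * I) with hIlef
  -- Riemann sums of `u` along rows/columns converge to the side integrals.
  -- rows: `N = m` or `m + 1`, height `h ∈ {z.im, w.im}`, row index `j(k)` with `|z.im + s_k j(k) - h| ≤ s_k`
  have hrow : ∀ (N : ℕ → ℕ) (jr : ℕ → ℤ) (h : ℝ), h ∈ Icc z.im w.im →
      (∀ k, N k = m k ∨ N k = m k + 1) → (∀ k, -1 ≤ jr k ∧ jr k ≤ n k + 1) →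
      (∀ k, |z.im + s k * jr k - h| ≤ s k) →
      Tendsto (fun k => (s k : ℂ) * ∑ t ∈ Finset.range (N k), u k (meshPoint (s k) (vtx (b k) t (jr k)))) atTop
        (𝓝 (∫ x : ℝ in z.re..w.re, g (x + h * I))) := by
    intro N jr h hh hN hjr hjh
    have hNℓ : Tendsto (fun k => (N k : ℝ) * s k) atTop (𝓝 ℓx) := by
      -- squeeze between `m s` and `(m+1) s`, both → ℓx
      have h1 : Tendsto (fun k => (m k : ℝ) * s k) atTop (𝓝 ℓx) := by
        refine tendsto_of_tendsto_of_tendsto_of_le_of_le (g := fun k => ℓx - s k) (h := fun k => ℓx) ?_ tendsto_const_nhds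
          (fun k => by have := (hfloorx k).2; simp only; nlinarith) (fun k => (hfloorx k).1)
        simpa using (tendsto_const_nhds (x := ℓx)).sub hs
      have h2 : Tendsto (fun k => ((m k : ℝ) + 1) * s k) atTop (𝓝 ℓx) := by
        have : Tendsto (fun k => (m k : ℝ) * s k + s k) atTop (𝓝 (ℓx + 0)) := h1.add hs
        rw [add_zero] at this
        exact this.congr fun k => by ring
      refine tendsto_of_tendsto_of_tendsto_of_le_of_le h1 h2 (fun k => ?_) (fun k => ?_)
      · rcases hN k with h' | h' <;> simp only [h'] <;> push_cast <;> nlinarith [hs0 k]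
      · rcases hN k with h' | h' <;> simp only [h'] <;> push_cast <;> nlinarith [hs0 k]
    have key := tendsto_mul_sum_of_tendstoUniformlyOn hK hg hconv hs0 hs hℓx0 hNℓ (p := (h : ℂ) * I) (v := 1)
      (by simp) (a₀ := z.re) (m₀ := r / 2) (by positivity)
      ((row_image_subset_cthickening z w hr hh hre).trans hKR) (C := 2) (by norm_num)
      (P := fun k t => meshPoint (s k) (vtx (b k) t (jr k))) (fun k t ht => ?_) (fun k t ht => ?_)
    · have e : (fun x : ℝ => g ((h : ℂ) * I + (x : ℂ) * 1)) = fun x : ℝ => g (x + h * I) := by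
        funext x; ring_nf
      rw [show z.re + ℓx = w.re by rw [hℓx]; ring, e] at key
      exact key
    · exact hgridK k t (jr k) (by omega) (by rcases hN k with h' | h' <;> omega) (hjr k).1 (hjr k).2
    · calc _ ≤ s k + |z.im + s k * jr k - h| := dist_meshPoint_vtx_row_le (hs0 k) z t (jr k) h
        _ ≤ s k + s k := by gcongr; exact hjh k
        _ = 2 * s k := by ring
  have hcol : ∀ (N : ℕ → ℕ) (ic : ℕ → ℤ) (h : ℝ), h ∈ Icc z.re w.re →
      (∀ k, N k = n k ∨ N k = n k + 1) → (∀ k, -1 ≤ ic k ∧ ic k ≤ m k + 1) →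
      (∀ k, |z.re + s k * ic k - h| ≤ s k) →
      Tendsto (fun k => (s k : ℂ) * ∑ t ∈ Finset.range (N k), u k (meshPoint (s k) (vtx (b k) (ic k) t))) atTop
        (𝓝 (∫ y : ℝ in z.im..w.im, g (h + y * I))) := by
    intro N ic h hh hN hic hih
    have hNℓ : Tendsto (fun k => (N k : ℝ) * s k) atTop (𝓝 ℓy) := by
      have h1 : Tendsto (fun k => (n k : ℝ) * s k) atTop (𝓝 ℓy) := by
        refine tendsto_of_tendsto_of_tendsto_of_le_of_le (g := fun k => ℓy - s k) (h := fun k => ℓy) ?_ tendsto_const_nhds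
          (fun k => by have := (hfloory k).2; simp only; nlinarith) (fun k => (hfloory k).1)
        simpa using (tendsto_const_nhds (x := ℓy)).sub hs
      have h2 : Tendsto (fun k => ((n k : ℝ) + 1) * s k) atTop (𝓝 ℓy) := by
        have : Tendsto (fun k => (n k : ℝ) * s k + s k) atTop (𝓝 (ℓy + 0)) := h1.add hs
        rw [add_zero] at this
        exact this.congr fun k => by ring
      refine tendsto_of_tendsto_of_tendsto_of_le_of_le h1 h2 (fun k => ?_) (fun k => ?_)
      · rcases hN k with h' | h' <;> simp only [h'] <;> push_cast <;> nlinarith [hs0 k]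
      · rcases hN k with h' | h' <;> simp only [h'] <;> push_cast <;> nlinarith [hs0 k]
    have key := tendsto_mul_sum_of_tendstoUniformlyOn hK hg hconv hs0 hs hℓy0 hNℓ (p := (h : ℂ)) (v := I)
      (by simp) (a₀ := z.im) (m₀ := r / 2) (by positivity)
      ((col_image_subset_cthickening z w hr hh him).trans hKR) (C := 2) (by norm_num)
      (P := fun k t => meshPoint (s k) (vtx (b k) (ic k) t)) (fun k t ht => ?_) (fun k t ht => ?_)
    · rw [show z.im + ℓy = w.im by rw [hℓy]; ring] at key
      exact key
    · exact hgridK k (ic k) t (hic k).1 (hic k).2 (by omega) (by rcases hN k with h' | h' <;> omega)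
    · calc _ ≤ s k + |z.re + s k * ic k - h| := dist_meshPoint_vtx_col_le (hs0 k) z (ic k) t h
        _ ≤ s k + s k := by gcongr; exact hih k
        _ = 2 * s k := by ring
  -- the eight renormalised sums, in terms of `u` (horizontal values) plus errors (vertical values)
  -- generic: `c_k Σ_{t<N} F(cSrc(x_t, 0)) = (1/2) (s_k Σ u(meshPoint x_t))`
  have hHsum : ∀ k (N : ℕ) (x : ℕ → Site 2),
      c k * ∑ t ∈ Finset.range N, F k (cSrc (x t, 0)) = (1 / 2 : ℂ) * ((s k : ℂ) * ∑ t ∈ Finset.range N, u k (meshPoint (s k) (x t))) := by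
    intro k N x
    simp_rw [hhor k, ← Finset.mul_sum, ← mul_assoc, hc_sqrt k]
    push_cast; ring
  -- generic: `‖c_k Σ_{t<N} (F(cSrc(x_t,1)) - F(cSrc(x_t,0)))‖ ≤ (L/2) (N s_k) s_k` for grid points
  have hVerr : ∀ k (N : ℕ) (x : ℕ → Site 2), (∀ t, t < N → meshPoint (s k) (x t) ∈ K) →
      ‖c k * ∑ t ∈ Finset.range N, (F k (cSrc (x t, 1)) - F k (cSrc (x t, 0)))‖ ≤ L / 2 * ((N : ℝ) * s k) * s k := by
    intro k N x hx
    have hsq : 0 < Real.sqrt (s k) := Real.sqrt_pos.2 (hs0 k)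
    have hck : ‖c k‖ = s k / 2 * (Real.sqrt (s k))⁻¹ := by
      rw [hc, norm_mul, norm_inv, Complex.norm_real, Complex.norm_real, Real.norm_eq_abs, Real.norm_eq_abs,
        abs_of_pos (by linarith [hs0 k]), abs_of_pos hsq]
    rw [norm_mul, hck]
    calc s k / 2 * (Real.sqrt (s k))⁻¹ * ‖∑ t ∈ Finset.range N, (F k (cSrc (x t, 1)) - F k (cSrc (x t, 0)))‖
        ≤ s k / 2 * (Real.sqrt (s k))⁻¹ * ∑ t ∈ Finset.range N, (L * s k * Real.sqrt (s k)) := by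
          gcongr
          · exact mul_nonneg (by linarith [hs0 k]) (inv_nonneg.2 hsq.le)
          · exact (norm_sum_le _ _).trans (Finset.sum_le_sum fun t ht => hcross k (x t) (hx t (Finset.mem_range.1 ht)))
      _ = L / 2 * ((N : ℝ) * s k) * s k := by
          rw [Finset.sum_const, Finset.card_range, nsmul_eq_mul]
          field_simp
  -- the error terms tend to zero: `(N_k s_k) s_k → ℓ · 0`
  have herr0 : ∀ (N : ℕ → ℕ) (ℓ : ℝ), Tendsto (fun k => (N k : ℝ) * s k) atTop (𝓝 ℓ) →
      ∀ (x : ℕ → ℕ → Site 2), (∀ k t, t < N k → meshPoint (s k) (x k t) ∈ K) →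
      Tendsto (fun k => c k * ∑ t ∈ Finset.range (N k), (F k (cSrc (x k t, 1)) - F k (cSrc (x k t, 0)))) atTop (𝓝 0) := by
    intro N ℓ hN x hx
    rw [tendsto_zero_iff_norm_tendsto_zero]
    have hlim : Tendsto (fun k => L / 2 * ((N k : ℝ) * s k) * s k) atTop (𝓝 0) := by
      have := (hN.const_mul (L / 2)).mul hs
      rw [mul_zero] at this
      exact this
    exact squeeze_zero (fun k => norm_nonneg _) (fun k => hVerr k (N k) (x k) (hx k)) hlim
  -- bookkeeping of the row/column indices
  have hvmid : ∀ k (i j : ℤ), vmid (F k) (b k) i j = F k (cSrc (vtx (b k) i j, 1)) := fun _ _ _ => rfl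
  have hhmid : ∀ k (i j : ℤ), hmid (F k) (b k) i j = F k (cSrc (vtx (b k) i j, 0)) := fun _ _ _ => rfl
  have hmN : Tendsto (fun k => ((m k + 1 : ℕ) : ℝ) * s k) atTop (𝓝 ℓx) := by
    have h1 : Tendsto (fun k => (m k : ℝ) * s k) atTop (𝓝 ℓx) := by
      refine tendsto_of_tendsto_of_tendsto_of_le_of_le (g := fun k => ℓx - s k) (h := fun k => ℓx) ?_ tendsto_const_nhds
        (fun k => by have := (hfloorx k).2; simp only; nlinarith) (fun k => (hfloorx k).1)
      simpa using (tendsto_const_nhds (x := ℓx)).sub hs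
    have : Tendsto (fun k => (m k : ℝ) * s k + s k) atTop (𝓝 (ℓx + 0)) := h1.add hs
    rw [add_zero] at this
    exact this.congr fun k => by push_cast; ring
  have hnN : Tendsto (fun k => ((n k : ℕ) : ℝ) * s k) atTop (𝓝 ℓy) := by
    refine tendsto_of_tendsto_of_tendsto_of_le_of_le (g := fun k => ℓy - s k) (h := fun k => ℓy) ?_ tendsto_const_nhds
      (fun k => by have := (hfloory k).2; simp only; nlinarith) (fun k => (hfloory k).1)
    simpa using (tendsto_const_nhds (x := ℓy)).sub hs
  have hjn : ∀ k, |z.im + s k * (n k : ℕ) - w.im| ≤ s k := by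
    intro k; have h' := hfloory k
    rw [abs_le]; constructor <;> nlinarith [h'.1, h'.2]
  have hj0 : ∀ k, |z.im + s k * ((0 : ℕ) : ℤ) - z.im| ≤ s k := by intro k; simp [(hs0 k).le]
  have hjm1 : ∀ k, |z.im + s k * (-1 : ℤ) - z.im| ≤ s k := by intro k; simp [abs_of_pos (hs0 k)]
  have him_ : ∀ k, |z.re + s k * (m k : ℕ) - w.re| ≤ s k := by
    intro k; have h' := hfloorx k
    rw [abs_le]; constructor <;> nlinarith [h'.1, h'.2]
  have hi0 : ∀ k, |z.re + s k * ((0 : ℕ) : ℤ) - z.re| ≤ s k := by intro k; simp [(hs0 k).le]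
  have him1 : ∀ k, |z.re + s k * (-1 : ℤ) - z.re| ≤ s k := by intro k; simp [abs_of_pos (hs0 k)]
  have hzim : z.im ∈ Icc z.im w.im := ⟨le_rfl, him⟩
  have hwim : w.im ∈ Icc z.im w.im := ⟨him, le_rfl⟩
  have hzre : z.re ∈ Icc z.re w.re := ⟨le_rfl, hre⟩
  have hwre : w.re ∈ Icc z.re w.re := ⟨hre, le_rfl⟩
  -- the eight limits
  -- A2: top row, horizontal values
  have LA2 : Tendsto (fun k => c k * ∑ i ∈ Finset.range (m k), hmid (F k) (b k) i (n k)) atTop (𝓝 ((1 / 2 : ℂ) * Itop)) := by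
    have h := (hrow m (fun k => n k) w.im hwim (fun k => Or.inl rfl) (fun k => ⟨by omega, by omega⟩) hjn).const_mul (1 / 2 : ℂ)
    refine h.congr fun k => ?_
    simp_rw [hhmid]; exact (hHsum k (m k) fun t => vtx (b k) t (n k)).symm
  -- B2: bottom row `j = 0`, horizontal values
  have LB2 : Tendsto (fun k => c k * ∑ i ∈ Finset.range (m k), hmid (F k) (b k) i 0) atTop (𝓝 ((1 / 2 : ℂ) * Ibot)) := by
    have h := (hrow m (fun _ => 0) z.im hzim (fun k => Or.inl rfl) (fun k => ⟨by omega, by omega⟩)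
      (fun k => by simpa using hj0 k)).const_mul (1 / 2 : ℂ)
    refine h.congr fun k => ?_
    simp_rw [hhmid]; exact (hHsum k (m k) fun t => vtx (b k) t 0).symm
  -- C1: right column `i = m`, horizontal values
  have LC1 : Tendsto (fun k => c k * ∑ j ∈ Finset.range (n k + 1), hmid (F k) (b k) (m k) j) atTop (𝓝 ((1 / 2 : ℂ) * Irig)) := by
    have h := (hcol (fun k => n k + 1) (fun k => m k) w.re hwre (fun k => Or.inr rfl) (fun k => ⟨by omega, by omega⟩) him_).const_mul (1 / 2 : ℂ)
    refine h.congr fun k => ?_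
    simp_rw [hhmid]; exact (hHsum k (n k + 1) fun t => vtx (b k) (m k) t).symm
  -- D1: left column `i = -1`, horizontal values
  have LD1 : Tendsto (fun k => c k * ∑ j ∈ Finset.range (n k + 1), hmid (F k) (b k) (-1) j) atTop (𝓝 ((1 / 2 : ℂ) * Ilef)) := by
    have h := (hcol (fun k => n k + 1) (fun _ => -1) z.re hzre (fun k => Or.inr rfl) (fun k => ⟨by omega, by omega⟩) him1).const_mul (1 / 2 : ℂ)
    refine h.congr fun k => ?_
    simp_rw [hhmid]; exact (hHsum k (n k + 1) fun t => vtx (b k) (-1) t).symm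
  -- vertical values: split `V = Hh + (V - Hh)`
  have hVsplit : ∀ k (N : ℕ) (x : ℕ → Site 2), c k * ∑ t ∈ Finset.range N, F k (cSrc (x t, 1)) =
      c k * ∑ t ∈ Finset.range N, F k (cSrc (x t, 0)) + c k * ∑ t ∈ Finset.range N, (F k (cSrc (x t, 1)) - F k (cSrc (x t, 0))) := by
    intro k N x; rw [← mul_add, ← Finset.sum_add_distrib]; congr 1
    exact Finset.sum_congr rfl fun t _ => by ring
  -- A1: top row, vertical values
  have LA1 : Tendsto (fun k => c k * ∑ i ∈ Finset.range (m k + 1), vmid (F k) (b k) i (n k)) atTop (𝓝 ((1 / 2 : ℂ) * Itop)) := by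
    have h1 := (hrow (fun k => m k + 1) (fun k => n k) w.im hwim (fun k => Or.inr rfl) (fun k => ⟨by omega, by omega⟩) hjn).const_mul (1 / 2 : ℂ)
    have h2 := herr0 (fun k => m k + 1) ℓx hmN (fun k t => vtx (b k) t (n k))
      (fun k t ht => hgridK k t (n k) (by omega) (by omega) (by omega) (by omega))
    have h := h1.add h2
    rw [add_zero] at h
    refine h.congr fun k => ?_
    simp_rw [hvmid]; rw [hVsplit, hHsum]
  -- B1: bottom row `j = -1`, vertical values
  have LB1 : Tendsto (fun k => c k * ∑ i ∈ Finset.range (m k + 1), vmid (F k) (b k) i (-1)) atTop (𝓝 ((1 / 2 : ℂ) * Ibot)) := by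
    have h1 := (hrow (fun k => m k + 1) (fun _ => -1) z.im hzim (fun k => Or.inr rfl) (fun k => ⟨by omega, by omega⟩) hjm1).const_mul (1 / 2 : ℂ)
    have h2 := herr0 (fun k => m k + 1) ℓx hmN (fun k t => vtx (b k) t (-1))
      (fun k t ht => hgridK k t (-1) (by omega) (by omega) (by omega) (by omega))
    have h := h1.add h2
    rw [add_zero] at h
    refine h.congr fun k => ?_
    simp_rw [hvmid]; rw [hVsplit, hHsum]
  -- C2: right column, vertical values
  have LC2 : Tendsto (fun k => c k * ∑ j ∈ Finset.range (n k), vmid (F k) (b k) (m k) j) atTop (𝓝 ((1 / 2 : ℂ) * Irig)) := by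
    have h1 := (hcol n (fun k => m k) w.re hwre (fun k => Or.inl rfl) (fun k => ⟨by omega, by omega⟩) him_).const_mul (1 / 2 : ℂ)
    have h2 := herr0 n ℓy hnN (fun k t => vtx (b k) (m k) t)
      (fun k t ht => hgridK k (m k) t (by omega) (by omega) (by omega) (by omega))
    have h := h1.add h2
    rw [add_zero] at h
    refine h.congr fun k => ?_
    simp_rw [hvmid]; rw [hVsplit, hHsum]
  -- D2: left column `i = 0`, vertical values
  have LD2 : Tendsto (fun k => c k * ∑ j ∈ Finset.range (n k), vmid (F k) (b k) 0 j) atTop (𝓝 ((1 / 2 : ℂ) * Ilef)) := by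
    have h1 := (hcol n (fun _ => 0) z.re hzre (fun k => Or.inl rfl) (fun k => ⟨by omega, by omega⟩)
      (fun k => by simpa using hi0 k)).const_mul (1 / 2 : ℂ)
    have h2 := herr0 n ℓy hnN (fun k t => vtx (b k) 0 t)
      (fun k t ht => hgridK k 0 t (by omega) (by omega) (by omega) (by omega))
    have h := h1.add h2
    rw [add_zero] at h
    refine h.congr fun k => ?_
    simp_rw [hvmid]; rw [hVsplit, hHsum]
  -- the renormalised contour sum `T k = c k * BS k = 0` and its limit
  have hT : Tendsto (fun k => (c k * ∑ i ∈ Finset.range (m k + 1), vmid (F k) (b k) i (n k) -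
        c k * ∑ i ∈ Finset.range (m k + 1), vmid (F k) (b k) i (-1)) +
      (c k * ∑ i ∈ Finset.range (m k), hmid (F k) (b k) i (n k) - c k * ∑ i ∈ Finset.range (m k), hmid (F k) (b k) i 0) -
      I * ((c k * ∑ j ∈ Finset.range (n k + 1), hmid (F k) (b k) (m k) j -
          c k * ∑ j ∈ Finset.range (n k + 1), hmid (F k) (b k) (-1) j) +
        (c k * ∑ j ∈ Finset.range (n k), vmid (F k) (b k) (m k) j - c k * ∑ j ∈ Finset.range (n k), vmid (F k) (b k) 0 j)))
      atTop (𝓝 (((1 / 2 : ℂ) * Itop - (1 / 2 : ℂ) * Ibot) + ((1 / 2 : ℂ) * Itop - (1 / 2 : ℂ) * Ibot) -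
        I * (((1 / 2 : ℂ) * Irig - (1 / 2 : ℂ) * Ilef) + ((1 / 2 : ℂ) * Irig - (1 / 2 : ℂ) * Ilef)))) :=
    ((LA1.sub LB1).add (LA2.sub LB2)).sub (((LC1.sub LD1).add (LC2.sub LD2)).const_mul I)
  have hT0 : ∀ k, (c k * ∑ i ∈ Finset.range (m k + 1), vmid (F k) (b k) i (n k) -
        c k * ∑ i ∈ Finset.range (m k + 1), vmid (F k) (b k) i (-1)) +
      (c k * ∑ i ∈ Finset.range (m k), hmid (F k) (b k) i (n k) - c k * ∑ i ∈ Finset.range (m k), hmid (F k) (b k) i 0) -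
      I * ((c k * ∑ j ∈ Finset.range (n k + 1), hmid (F k) (b k) (m k) j -
          c k * ∑ j ∈ Finset.range (n k + 1), hmid (F k) (b k) (-1) j) +
        (c k * ∑ j ∈ Finset.range (n k), vmid (F k) (b k) (m k) j - c k * ∑ j ∈ Finset.range (n k), vmid (F k) (b k) 0 j)) = 0 := by
    intro k
    have h := congrArg (fun t => c k * t) (hBS k)
    simp only [mul_zero, Finset.sum_sub_distrib] at h
    rw [← h]; ring
  have hlim0 : ((1 / 2 : ℂ) * Itop - (1 / 2 : ℂ) * Ibot) + ((1 / 2 : ℂ) * Itop - (1 / 2 : ℂ) * Ibot) -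
      I * (((1 / 2 : ℂ) * Irig - (1 / 2 : ℂ) * Ilef) + ((1 / 2 : ℂ) * Irig - (1 / 2 : ℂ) * Ilef)) = 0 := by
    refine tendsto_nhds_unique hT ?_
    exact tendsto_const_nhds.congr fun k => (hT0 k).symm
  rw [Complex.wedgeIntegral_add_wedgeIntegral_eq]
  simp only [smul_eq_mul]
  linear_combination (-1 : ℂ) * hlim0

end Core

/-! ### Morera: the limit is holomorphic -/

section Morera

variable {D : RandomPlanarGeometry.DobrushinDomain} {E : ℝ → DiscreteDobrushin}

/-- Shifting the index of a uniformly convergent sequence. [folklore] -/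
theorem tendstoUniformlyOn_shift {F : ℕ → ℂ → ℂ} {f : ℂ → ℂ} {K : Set ℂ} (h : TendstoUniformlyOn F f atTop K) (k₀ : ℕ) :
    TendstoUniformlyOn (fun k => F (k + k₀)) f atTop K := by
  rw [Metric.tendstoUniformlyOn_iff] at h ⊢
  exact fun ε hε => (tendsto_add_atTop_nat k₀).eventually (h ε hε)

/-- The rectangle is symmetric in its corners and under switching to the other diagonal. [folklore] -/
theorem rectangle_eq_of_diag (z w : ℂ) : Rectangle (⟨z.re, w.im⟩ : ℂ) ⟨w.re, z.im⟩ = Rectangle z w := by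
  simp [Rectangle, Set.uIcc_comm]

/-- **Subsequential limits of `δ^{-1/2} F_δ` are holomorphic** (Smirnov 2010, §5: "by Morera's
theorem the limit is analytic", via the discrete Cauchy theorem `boundary_sum_eq_zero_of_cr` and
Riemann sums). [cite: Smirnov2010, §5 (proof of Theorem 2.2, Morera step)] -/
theorem IsDiscretisation.differentiableOn_of_limit (hDE : IsDiscretisation D E)
    (hyp : ∀ᶠ δ in 𝓝[>] (0 : ℝ), ObsHyp (E δ))
    {s : ℕ → ℝ} (hs : Tendsto s atTop (𝓝[>] (0 : ℝ))) {g : ℂ → ℂ} (hg : ContinuousOn g D.carrier)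
    (hconv : ∀ K ⊆ D.carrier, IsCompact K → TendstoUniformlyOn (scaledObs E s) g atTop K) :
    DifferentiableOn ℂ g D.carrier := by
  -- main case: ordered corners
  have main : ∀ z w : ℂ, z.re ≤ w.re → z.im ≤ w.im → Rectangle z w ⊆ D.carrier →
      wedgeIntegral z w g + wedgeIntegral w z g = 0 := by
    intro z w hre him hR
    have hRc : IsCompact (Rectangle z w) := isCompact_uIcc.reProdIm isCompact_uIcc
    obtain ⟨r, hr, hrD⟩ := hRc.exists_cthickening_subset_open D.isOpen hR
    set K := cthickening r (Rectangle z w) with hKdef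
    have hK : IsCompact K := hRc.cthickening
    have hKD : K ⊆ D.carrier := hrD
    obtain ⟨ρ, hρ, hbulk⟩ := hDE.exists_bulk_radius hK hKD
    obtain ⟨L, -, hcross⟩ := hDE.exists_cross_bound hyp hK hKD
    have hsmall : ∀ᶠ δ in 𝓝[>] (0 : ℝ), δ < min (r / 3) (ρ / 6) :=
      nhdsWithin_le_nhds (Iio_mem_nhds (by positivity))
    have hall := hs.eventually (((hyp.and hbulk).and hcross).and
      (hsmall.and (self_mem_nhdsWithin : ∀ᶠ δ in 𝓝[>] (0 : ℝ), 0 < δ)))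
    obtain ⟨k₀, hk₀⟩ := eventually_atTop.1 hall
    -- shift the sequence
    set s' : ℕ → ℝ := fun k => s (k + k₀) with hs'
    have hk : ∀ k, ((ObsHyp (E (s' k)) ∧ (∀ x y : Site 2, meshPoint (s' k) x ∈ K →
        dist (meshPoint (s' k) y) (meshPoint (s' k) x) ≤ ρ → ∀ e : Fin 4, (E (s' k)).IsInteriorEdge y e)) ∧
        (∀ x : Site 2, meshPoint (s' k) x ∈ K → ∀ hE : (E (s' k)).IsZdAdmissible,
          ‖obsAt (E (s' k)) hE (cSrc (x, 1)) - obsAt (E (s' k)) hE (cSrc (x, 0))‖ ≤ L * s' k * Real.sqrt (s' k))) ∧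
        (s' k < min (r / 3) (ρ / 6) ∧ 0 < s' k) := fun k => hk₀ (k + k₀) (Nat.le_add_left _ _)
    have H : ∀ k, ObsHyp (E (s' k)) := fun k => (hk k).1.1.1
    have hs'0 : ∀ k, 0 < s' k := fun k => (hk k).2.2
    have hs'lim : Tendsto s' atTop (𝓝 0) := (hs.mono_right nhdsWithin_le_nhds).comp (tendsto_add_atTop_nat k₀)
    have hconv' : TendstoUniformlyOn (scaledObs E s') g atTop K := tendstoUniformlyOn_shift (hconv K hKD hK) k₀
    refine wedgeIntegral_add_eq_zero_core hDE hs'0 hs'lim hre him hK (hg.mono hKD) hr Subset.rfl hconv' H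
      (fun k => ?_) (fun k x y hx hxy e => (hk k).1.1.2 x y hx hxy e) (fun k => ?_)
      (fun k x hx => (hk k).1.2 x hx (H k).adm)
    · have := (hk k).2.1; have := min_le_left (r / 3) (ρ / 6); linarith
    · have := (hk k).2.1; have := min_le_right (r / 3) (ρ / 6); linarith
  -- all corner configurations
  have aux : ∀ z w : ℂ, z.re ≤ w.re → Rectangle z w ⊆ D.carrier → wedgeIntegral z w g + wedgeIntegral w z g = 0 := by
    intro z w hre hR
    rcases le_total z.im w.im with him | him
    · exact main z w hre him hR
    · have hR' : Rectangle (⟨z.re, w.im⟩ : ℂ) ⟨w.re, z.im⟩ ⊆ D.carrier := by rwa [rectangle_eq_of_diag]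
      have h := main ⟨z.re, w.im⟩ ⟨w.re, z.im⟩ hre him hR'
      rw [Complex.wedgeIntegral_add_wedgeIntegral_eq] at h ⊢
      simp only at h
      rw [intervalIntegral.integral_symm z.im w.im, intervalIntegral.integral_symm z.im w.im] at h
      linear_combination (-1 : ℂ) * h
  refine ((Complex.isConservativeOn_and_continuousOn_iff_isDifferentiableOn D.isOpen).1 ⟨?_, hg⟩)
  intro z w hR
  rcases le_total z.re w.re with hre | hre
  · exact eq_neg_of_add_eq_zero_left (aux z w hre hR)
  · have hR' : Rectangle w z ⊆ D.carrier := by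
      rwa [show Rectangle w z = Rectangle z w by simp [Rectangle, Set.uIcc_comm]]
    have h := aux w z hre hR'
    rw [add_comm] at h
    exact eq_neg_of_add_eq_zero_left h

end Morera

end Literature.Probability.LatticeModels
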